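import Summits.QuantumFields.BalabanUV.T4Continuum.Spine.NE1p.DressedSmallFieldRecordLabelsCarriersBonds

/-!
# T⁴ programme, spine estimate NE1′ (node O3b/H2) — THE KILL CONVENTION: N1a's displayed `hkill` IS DISCHARGEABLE BY CONSTRUCTION OF
# THE LETTERS, and N0y's ENDs AT THE CARRIERS OF RECORD hold FOR THE LABELS OF RECORD OF ANY LETTER FAMILY `ℓ₀` — with NO `hkill`

Cell `pub-balaban`, sub-cell `t4`, BINDER-OWNERS row NE1′; NE1′ formalisation crew, unit b2b-balaban-t4-ne1p-formalise-leaf-05,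
generation 12; crew row W91 ∕ DAG N29zzzzzb of `t4/formal/NE1p/LEAVES.md` (BOOKED typer R-T149, `CLAIMS.log` l.24193; INTENT l.24114;
owner «GO — THIS SHAPE» l.24144; read X232) = N1a's KILL-CONVENTION FACE (crew; the owner's node N1b is RESERVED for a killing predicate
READ FROM PRINT) — the owner's OPEN OFFER O-owner-g32-1 (`CLAIMS.log` 2026-08-20 l.23674) taken up by the crew.  ADDITIVE — imports owner
N1a PART 3 `Spine/NE1p/DressedSmallFieldRecordLabelsCarriersBonds` ONLY (→ N1a P2∕P1, substrate (A) `SubstrateNestedToriOfRecord`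
(`torusLabels`, `InnerLabel.ofTorus(_injective)`, `sum_innerLabels_domEmb_eq`), (B) `SubstrateSlotActZero` (`actOfLetters_eq_zero_of_mem_cons`),
`SubstrateActivities` (`CoreLetters`, `coreOf`, `actOfLetters(_apply)`), W-23c `SubstrateBondsOfCubes` (`bondsOfFineCubes`) — all BY NAME);
ONE data `def` (`killConv`, over the displayed SHAPE `CoreLetters`) + THEOREMS; 0 `def … : Prop`, 0 cite, 0 sorry; nothing restated.

WHAT.  N1a's ENDs display `hkill : ∀ Z, ∀ ℓ ∈ torusLabels hk Z, ¬ FILTER Z ℓ → ∃ b thr, thr ≤ 0 ∧ (b, thr, true) ∈ (ℓA (domEmb Z) (ofTorus ℓ)).cons`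
over a FREE letter family `ℓA` — «every catalogue label failing the owner's filter carries a killing χ-letter» (NE5's READING; the owner's
structural note l.23674: over abstract letters `hkill` has no owner-side discharge).  This file shows in kernel that `hkill` is a CONVENTION
on the letters, dischargeable BY CONSTRUCTION, and what N0y's ENDs then say WITHOUT it:
* §1 `killConv hk … ℓ₀` := `ℓ₀` with the killing letter `(0, 0, true)` PREPENDED to `cons` at exactly the factors `(domEmb R (k+1) Z,
  InnerLabel.ofTorus hk ℓ)`, `ℓ ∈ torusLabels hk Z` FAILING the filter (a classical `if` over the SHAPE; `N`, `q`, `κ₁`, radii, `B` untouched: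
  `killConv_N`, `killConv_q`); `mem_cons_killConv_of_not`; **`hkill_killConv`** = N1a's `hkill` binder VERBATIM at `ℓA := killConv … ℓ₀`,
  proved by `⟨0, 0, le_rfl, mem⟩`; `killConv_apply_of_filter`: at a label PASSING the filter the letters ARE `ℓ₀`'s (`domEmb` and
  `InnerLabel.ofTorus` injective — no other torus label shares the factor).
* §2 `coreOf_congr` (the core of record reads the letters at its own factor only); `coreOf_killConv_lam`∕`_wB`∕`_N₁` (the convention
  touches `cons` only); `actOfLetters_killConv_of_not` (= 0, (B) BY NAME at threshold 0) ∕ `_of_filter` (= `ℓ₀`'s);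
  **`sum_innerLabels_actOfLetters_killConv`**: ROW NE5's catalogue sum of the convention's activities at `domEmb R (k+1) Z` IS the sum of
  `ℓ₀`'s activities over `(torusLabels hk Z).filter FILTER` ((A)'s `sum_innerLabels_domEmb_eq` BY NAME + `Finset.sum_filter`).
* §3 **`attachedPart_∕muPart_locE_le_of_actOfLetters_recordLabels_any`**: N1a PART 3's two ENDs ONCE each at `ℓA := killConv … ℓ₀` with
  `hkill` DISCHARGED by §1, the letters' binders `hN`∕`hq`∕`hAmp` transported from `ℓ₀`'s by §1∕§2's `simp` lemmas, and the conclusion's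
  catalogue sums rewritten by §2 — i.e. N0y's bounds AT THE CARRIERS OF RECORD for the activity of record of ANY letter family `ℓ₀` SUMMED
  OVER THE LABELS OF RECORD (the owner's filter) ONLY, with every other binder of N1a displayed verbatim and NO `hkill`.
«Which labels» has moved from a hypothesis on the letters to the summation RANGE.  Nothing of N1a∕N0y∕(A)∕(B)∕W-23c is restated.

PRINTED LOCI (TYPE∕CONTEXT only — [Balaban1988RGII] = CMP 116 (1988)): p. 12 (the constraints on the localization domains and on the bonds
of `P` in (2.14); the finer ones «left to the term definition (zero terms)» in ROW NE5's `innerLabels`), p. 18 (the count).  No numeral of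
print is asserted; nothing here is used as a fact about Bałaban's densities.

HONEST FRAMING.  Letter bookkeeping over the displayed SHAPE `CoreLetters` + two by-name applications of the owner's ENDs; `killConv`
declares BY FIAT that exactly the labels outside the owner's filter are killed — it does NOT identify which of Bałaban's (2.14) terms vanish
on Bałaban's densities (NE5's READING of p. 12), so (B1b) at NE5's index is NOT discharged thereby: it is RELOCATED from `hkill` to the claim
that the FILTERED sum IS Bałaban's resummed (2.14) small-field expansion at `Z`, which stays NE5's ∕ the substrate's to supply; this is N1a's
kill-convention FACE — N1b RESERVED for a predicate read from print; no wall item; `hAmp` ((B3-form) READING) and every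
other binder displayed; 0 binders instantiated on Bałaban's (2.14) densities; wall v1.8 (T4-DAG v48; v49–v51 same words — words, not kind)
does NOT move; R-t4r2-Q2 NOT met thereby; NE1′ ⇐ the named binders — NOT printed, NOT proved; spine PROVED 0∕9; count 9 unchanged.
ABSOLUTE RULE honoured ([folklore] kernel theorems only; printed loci TYPE∕CONTEXT).  Rung (B)+1 on ONE finite four-torus — NOT infinite
volume, NOT a mass gap, NOT OS on ℝ⁴, NOT Clay.  HONEST DEPENDENCY: continuum YM on T⁴ ⇐ BetaPertH ∧ nine spine estimates (0/9 proved);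
BetaPertH ⇐ (D1) ∧ (D4) ∧ CAP+tail; G-an2-4 gates asym, D1 and NE2/3/4. -/

noncomputable section

namespace Summit.QuantumFields.BalabanUV.T4Continuum.NE1p.DressedSmallFieldRecordLabelsKillConvention

open Metric Set Complex MeasureTheory
open scoped BigOperators
open Literature.MathematicalPhysics.QuantumFieldTheory.Balaban1983to89 (GaugeGroup)
open Literature.MathematicalPhysics.QuantumFieldTheory.Balaban1983to89.T4OutputRate (Carriers)
open Literature.MathematicalPhysics.QuantumFieldTheory.Balaban1983to89.B13Resummation (locE)
open Literature.MathematicalPhysics.QuantumFieldTheory.Balaban1983to89.TreeLengthTorus (TPt TDom tsys torusTreeLen)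
open Literature.MathematicalPhysics.QuantumFieldTheory.Balaban1983to89.TreeLengthTorusGeometry (tgeometry)
open Literature.MathematicalPhysics.QuantumFieldTheory.Balaban1983to89.B12TreeDecay (K₀)
open Summit.QuantumFields.BalabanUV.T4Continuum.B13HistMeasurable (MeasPotFrame B13HistM)
open Summit.QuantumFields.BalabanUV.T4Continuum.B13StepTermLabels (InnerLabel innerLabels)
open Summit.QuantumFields.BalabanUV.T4Continuum.B13Carriers (TwoRuns)
open Summit.QuantumFields.BalabanUV.T4Continuum.B13InnerData (Bnd b13InnerData)
open Summit.QuantumFields.BalabanUV.T4Continuum.B13DomainGeometryTR (domEmb)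
open Summit.QuantumFields.BalabanUV.T4Continuum.SubstrateActivities (CoreLetters coreOf actOfLetters)
open Summit.QuantumFields.BalabanUV.T4Continuum.SubstrateSlotActZero (actOfLetters_eq_zero_of_mem_cons)
open Summit.QuantumFields.BalabanUV.T4Continuum.SubstrateNestedToriOfRecord (InnerLabel.ofTorus InnerLabel.ofTorus_injective torusLabels
  sum_innerLabels_domEmb_eq)
open Summit.QuantumFields.BalabanUV.T4Continuum.SubstrateBondsOfCubes (bondsOfFineCubes)
open Summit.QuantumFields.BalabanUV.T4Continuum.TorusBlockRefinement (trefineDom)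
open Summit.QuantumFields.BalabanUV.T4Continuum.NE1p.DressedSmallFieldRecordLabelsCarriersBonds
  (attachedPart_locE_le_of_actOfLetters_recordLabels_carriersBonds muPart_locE_le_of_actOfLetters_recordLabels_carriersBonds)

section KillConvention

variable {G : Type} [GaugeGroup G] {R : TwoRuns G} {k : ℕ} (hk : k + 1 + R.m' ≤ R.F.m + R.K)
variable (P : MeasPotFrame R.carriers) (Op : Type*)
  (𝒴 : R.carriers.Dom → InnerLabel R.carriers.Dom (Bnd R) → Type) (dom : ∀ X j, 𝒴 X j → R.carriers.Dom)
  (Jc : R.carriers.Dom → InnerLabel R.carriers.Dom (Bnd R) → Type)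
  (V : R.carriers.Dom → InnerLabel R.carriers.Dom (Bnd R) → Type) [∀ X j, NormedAddCommGroup (V X j)]
  [∀ X j, InnerProductSpace ℝ (V X j)] [∀ X j, MeasurableSpace (V X j)]

/-! ## §1 The kill convention on a letter family (letters only) -/

open Classical in
/-- **THE KILL CONVENTION** `killConv hk … ℓ₀`: the letter family `ℓ₀` with the killing χ-letter `(0, 0, true)` (bond read-out `0`,
threshold `0`, small-field flag) PREPENDED to `cons` at exactly the factors `(domEmb R (k+1) Z, InnerLabel.ofTorus hk ℓ)` of a torus label
`ℓ ∈ torusLabels hk Z` FAILING the owner's filter `ℓ.Z₀ = trefineDom L N Z ∧ ℓ.P ⊆ bondsOfFineCubes hk (Z₀ ∖ ∪fam) ∧ #(Z₀ ∖ ∪fam) ≤ 2·#ℓ.P`;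
every other factor's letters are `ℓ₀`'s.  DATA over the displayed SHAPE `CoreLetters`; nothing of Bałaban's. [folklore] -/
def killConv (ℓ₀ : ∀ X j, CoreLetters P Op 𝒴 dom Jc V X j) : ∀ X j, CoreLetters P Op 𝒴 dom Jc V X j := fun X j =>
  if ∃ (Z : (tsys 4 (R.cubesPerDir (k + 1))).Dom) (ℓ : InnerLabel (TDom 4 (R.F.L * R.cubesPerDir (k + 1))) (Bnd R)),
      ℓ ∈ torusLabels hk Z ∧ domEmb R (k + 1) Z = X ∧ InnerLabel.ofTorus hk ℓ = j ∧
        ¬ (ℓ.Z₀ = trefineDom R.F.L (R.cubesPerDir (k + 1)) Z ∧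
            ℓ.P ⊆ bondsOfFineCubes hk (ℓ.Z₀.1 \ ℓ.fam.biUnion fun Y : (tsys 4 (R.F.L * R.cubesPerDir (k + 1))).Dom => Y.1) ∧
            (ℓ.Z₀.1 \ ℓ.fam.biUnion fun Y : (tsys 4 (R.F.L * R.cubesPerDir (k + 1))).Dom => Y.1).card ≤ 2 * ℓ.P.card) then
    { ℓ₀ X j with cons := ((0 : V X j →L[ℝ] ℝ), (0 : ℝ), true) :: (ℓ₀ X j).cons }
  else ℓ₀ X j

variable (ℓ₀ : ∀ X j, CoreLetters P Op 𝒴 dom Jc V X j)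

/-- [folklore] The convention touches `cons` only: the Gaussian letter `N` is `ℓ₀`'s at every factor. -/
@[simp] theorem killConv_N (X : R.carriers.Dom) (j : InnerLabel R.carriers.Dom (Bnd R)) :
    (killConv hk P Op 𝒴 dom Jc V ℓ₀ X j).N = (ℓ₀ X j).N := by
  unfold killConv; split_ifs <;> rfl

/-- [folklore] The convention touches `cons` only: the quadratic letter `q` is `ℓ₀`'s at every factor. -/
@[simp] theorem killConv_q (X : R.carriers.Dom) (j : InnerLabel R.carriers.Dom (Bnd R)) :
    (killConv hk P Op 𝒴 dom Jc V ℓ₀ X j).q = (ℓ₀ X j).q := by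
  unfold killConv; split_ifs <;> rfl

/-- [folklore] **AT A LABEL OF RECORD FAILING THE FILTER THE KILLING LETTER IS PRESENT.** -/
theorem mem_cons_killConv_of_not {Z : (tsys 4 (R.cubesPerDir (k + 1))).Dom}
    {ℓ : InnerLabel (TDom 4 (R.F.L * R.cubesPerDir (k + 1))) (Bnd R)} (hℓ : ℓ ∈ torusLabels hk Z)
    (hnot : ¬ (ℓ.Z₀ = trefineDom R.F.L (R.cubesPerDir (k + 1)) Z ∧
      ℓ.P ⊆ bondsOfFineCubes hk (ℓ.Z₀.1 \ ℓ.fam.biUnion fun Y : (tsys 4 (R.F.L * R.cubesPerDir (k + 1))).Dom => Y.1) ∧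
      (ℓ.Z₀.1 \ ℓ.fam.biUnion fun Y : (tsys 4 (R.F.L * R.cubesPerDir (k + 1))).Dom => Y.1).card ≤ 2 * ℓ.P.card)) :
    ((0 : V (domEmb R (k + 1) Z) (InnerLabel.ofTorus hk ℓ) →L[ℝ] ℝ), (0 : ℝ), true) ∈
      (killConv hk P Op 𝒴 dom Jc V ℓ₀ (domEmb R (k + 1) Z) (InnerLabel.ofTorus hk ℓ)).cons := by
  unfold killConv
  split_ifs with h
  · exact List.mem_cons_self
  · exact absurd ⟨Z, ℓ, hℓ, rfl, rfl, hnot⟩ h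

/-- [folklore] **THE DISPLAYED `hkill` OF N1a IS DISCHARGED BY THE CONVENTION** (the owner's binder shape verbatim, at `ℓA := killConv … ℓ₀`). -/
theorem hkill_killConv : ∀ Z : (tsys 4 (R.cubesPerDir (k + 1))).Dom, ∀ ℓ ∈ torusLabels hk Z,
    ¬ (ℓ.Z₀ = trefineDom R.F.L (R.cubesPerDir (k + 1)) Z ∧
        ℓ.P ⊆ bondsOfFineCubes hk (ℓ.Z₀.1 \ ℓ.fam.biUnion fun Y : (tsys 4 (R.F.L * R.cubesPerDir (k + 1))).Dom => Y.1) ∧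
        (ℓ.Z₀.1 \ ℓ.fam.biUnion fun Y : (tsys 4 (R.F.L * R.cubesPerDir (k + 1))).Dom => Y.1).card ≤ 2 * ℓ.P.card) →
    ∃ (b : V (domEmb R (k + 1) Z) (InnerLabel.ofTorus hk ℓ) →L[ℝ] ℝ) (thr : ℝ), thr ≤ 0 ∧
      (b, thr, true) ∈ (killConv hk P Op 𝒴 dom Jc V ℓ₀ (domEmb R (k + 1) Z) (InnerLabel.ofTorus hk ℓ)).cons :=
  fun _ _ hℓ hnot => ⟨0, 0, le_rfl, mem_cons_killConv_of_not hk P Op 𝒴 dom Jc V ℓ₀ hℓ hnot⟩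

/-- [folklore] **AT A LABEL OF RECORD PASSING THE FILTER THE LETTERS ARE UNTOUCHED** (`domEmb` and `InnerLabel.ofTorus` are injective, so no
other torus label shares the factor). -/
theorem killConv_apply_of_filter {Z : (tsys 4 (R.cubesPerDir (k + 1))).Dom}
    {ℓ : InnerLabel (TDom 4 (R.F.L * R.cubesPerDir (k + 1))) (Bnd R)}
    (hfilt : ℓ.Z₀ = trefineDom R.F.L (R.cubesPerDir (k + 1)) Z ∧
      ℓ.P ⊆ bondsOfFineCubes hk (ℓ.Z₀.1 \ ℓ.fam.biUnion fun Y : (tsys 4 (R.F.L * R.cubesPerDir (k + 1))).Dom => Y.1) ∧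
      (ℓ.Z₀.1 \ ℓ.fam.biUnion fun Y : (tsys 4 (R.F.L * R.cubesPerDir (k + 1))).Dom => Y.1).card ≤ 2 * ℓ.P.card) :
    killConv hk P Op 𝒴 dom Jc V ℓ₀ (domEmb R (k + 1) Z) (InnerLabel.ofTorus hk ℓ) = ℓ₀ (domEmb R (k + 1) Z) (InnerLabel.ofTorus hk ℓ) := by
  unfold killConv
  split_ifs with h
  · exfalso
    obtain ⟨Z', ℓ', -, hZ, hℓ', hnot⟩ := h
    obtain rfl : Z' = Z := (domEmb R (k + 1)).injective hZ
    obtain rfl : ℓ' = ℓ := InnerLabel.ofTorus_injective hk hℓ'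
    exact hnot hfilt
  · rfl

variable [∀ X j, Fintype (𝒴 X j)] [∀ X j, Fintype (Jc X j)]

/-! ## §2 The cores and the activities under the convention -/

/-- [folklore] The core of record reads the letters AT ITS OWN FACTOR only (`coreOf`'s definition, as a congruence). -/
theorem coreOf_congr {ℓ ℓ' : ∀ X j, CoreLetters P Op 𝒴 dom Jc V X j} {X : R.carriers.Dom} {j : InnerLabel R.carriers.Dom (Bnd R)}
    (h : ℓ X j = ℓ' X j) : coreOf P Op 𝒴 dom Jc V ℓ X j = coreOf P Op 𝒴 dom Jc V ℓ' X j :=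
  congrArg (fun c : CoreLetters P Op 𝒴 dom Jc V X j =>
    B13TermContourCore.ofContours P (dom X j) (Jc X j) c.κ₁_pos c.one_lt_r c.N c.q c.cons c.nsign c.B c.measB) h

/-- [folklore] The core's contour-parameter measure `lam` is `ℓ₀`'s at every factor (it never reads `cons`). -/
@[simp] theorem coreOf_killConv_lam (X : R.carriers.Dom) (j : InnerLabel R.carriers.Dom (Bnd R)) :
    (coreOf P Op 𝒴 dom Jc V (killConv hk P Op 𝒴 dom Jc V ℓ₀) X j).lam = (coreOf P Op 𝒴 dom Jc V ℓ₀ X j).lam := by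
  unfold coreOf killConv; split_ifs <;> rfl

/-- [folklore] The core's Cauchy-weight letter `wB` is `ℓ₀`'s at every factor (it reads `κ₁` and the radii only). -/
@[simp] theorem coreOf_killConv_wB (X : R.carriers.Dom) (j : InnerLabel R.carriers.Dom (Bnd R)) :
    (coreOf P Op 𝒴 dom Jc V (killConv hk P Op 𝒴 dom Jc V ℓ₀) X j).wB = (coreOf P Op 𝒴 dom Jc V ℓ₀ X j).wB := by
  unfold coreOf killConv; split_ifs <;> rfl

/-- [folklore] The core's history read-out letter `N₁` is `ℓ₀`'s at every factor (it reads the radii only). -/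
@[simp] theorem coreOf_killConv_N₁ (X : R.carriers.Dom) (j : InnerLabel R.carriers.Dom (Bnd R)) :
    (coreOf P Op 𝒴 dom Jc V (killConv hk P Op 𝒴 dom Jc V ℓ₀) X j).N₁ = (coreOf P Op 𝒴 dom Jc V ℓ₀ X j).N₁ := by
  unfold coreOf killConv; split_ifs <;> rfl

variable [∀ X j, BorelSpace (V X j)] [∀ X j, FiniteDimensional ℝ (V X j)]

/-- [folklore] **A KILLED FACTOR HAS ACTIVITY ZERO** ((B)'s `actOfLetters_eq_zero_of_mem_cons` BY NAME at threshold `0`). -/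
theorem actOfLetters_killConv_of_not {Z : (tsys 4 (R.cubesPerDir (k + 1))).Dom}
    {ℓ : InnerLabel (TDom 4 (R.F.L * R.cubesPerDir (k + 1))) (Bnd R)} (hℓ : ℓ ∈ torusLabels hk Z)
    (hnot : ¬ (ℓ.Z₀ = trefineDom R.F.L (R.cubesPerDir (k + 1)) Z ∧
      ℓ.P ⊆ bondsOfFineCubes hk (ℓ.Z₀.1 \ ℓ.fam.biUnion fun Y : (tsys 4 (R.F.L * R.cubesPerDir (k + 1))).Dom => Y.1) ∧
      (ℓ.Z₀.1 \ ℓ.fam.biUnion fun Y : (tsys 4 (R.F.L * R.cubesPerDir (k + 1))).Dom => Y.1).card ≤ 2 * ℓ.P.card))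
    (o : Op) (y : B13HistM P) :
    actOfLetters P Op 𝒴 dom Jc V (killConv hk P Op 𝒴 dom Jc V ℓ₀) (domEmb R (k + 1) Z) (InnerLabel.ofTorus hk ℓ) o y = 0 :=
  actOfLetters_eq_zero_of_mem_cons P Op 𝒴 dom Jc V _ (mem_cons_killConv_of_not hk P Op 𝒴 dom Jc V ℓ₀ hℓ hnot) le_rfl o y

/-- [folklore] **A PASSING FACTOR HAS `ℓ₀`'s ACTIVITY** (the activity of record reads the letters at its own factor only). -/
theorem actOfLetters_killConv_of_filter {Z : (tsys 4 (R.cubesPerDir (k + 1))).Dom}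
    {ℓ : InnerLabel (TDom 4 (R.F.L * R.cubesPerDir (k + 1))) (Bnd R)}
    (hfilt : ℓ.Z₀ = trefineDom R.F.L (R.cubesPerDir (k + 1)) Z ∧
      ℓ.P ⊆ bondsOfFineCubes hk (ℓ.Z₀.1 \ ℓ.fam.biUnion fun Y : (tsys 4 (R.F.L * R.cubesPerDir (k + 1))).Dom => Y.1) ∧
      (ℓ.Z₀.1 \ ℓ.fam.biUnion fun Y : (tsys 4 (R.F.L * R.cubesPerDir (k + 1))).Dom => Y.1).card ≤ 2 * ℓ.P.card)
    (o : Op) (y : B13HistM P) :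
    actOfLetters P Op 𝒴 dom Jc V (killConv hk P Op 𝒴 dom Jc V ℓ₀) (domEmb R (k + 1) Z) (InnerLabel.ofTorus hk ℓ) o y =
      actOfLetters P Op 𝒴 dom Jc V ℓ₀ (domEmb R (k + 1) Z) (InnerLabel.ofTorus hk ℓ) o y := by
  rw [SubstrateActivities.actOfLetters_apply, SubstrateActivities.actOfLetters_apply,
    coreOf_congr P Op 𝒴 dom Jc V (killConv_apply_of_filter hk P Op 𝒴 dom Jc V ℓ₀ hfilt)]

open Classical in
/-- [folklore] **ROW NE5's CATALOGUE SUM UNDER THE CONVENTION IS THE FILTERED SUM OF `ℓ₀`'s ACTIVITIES** at every scale-`(k+1)` polymer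
((A)'s `sum_innerLabels_domEmb_eq` BY NAME, then the killed labels drop out). -/
theorem sum_innerLabels_actOfLetters_killConv (Z : (tsys 4 (R.cubesPerDir (k + 1))).Dom) (o : Op) (y : B13HistM P) :
    ∑ ℓ' ∈ innerLabels (b13InnerData R) (k + 1) (domEmb R (k + 1) Z),
        actOfLetters P Op 𝒴 dom Jc V (killConv hk P Op 𝒴 dom Jc V ℓ₀) (domEmb R (k + 1) Z) ℓ' o y =
      ∑ ℓ ∈ (torusLabels hk Z).filter fun ℓ =>
          ℓ.Z₀ = trefineDom R.F.L (R.cubesPerDir (k + 1)) Z ∧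
            ℓ.P ⊆ bondsOfFineCubes hk (ℓ.Z₀.1 \ ℓ.fam.biUnion fun Y : (tsys 4 (R.F.L * R.cubesPerDir (k + 1))).Dom => Y.1) ∧
            (ℓ.Z₀.1 \ ℓ.fam.biUnion fun Y : (tsys 4 (R.F.L * R.cubesPerDir (k + 1))).Dom => Y.1).card ≤ 2 * ℓ.P.card,
        actOfLetters P Op 𝒴 dom Jc V ℓ₀ (domEmb R (k + 1) Z) (InnerLabel.ofTorus hk ℓ) o y := by
  rw [sum_innerLabels_domEmb_eq hk Z, Finset.sum_filter]
  refine Finset.sum_congr rfl fun ℓ hℓ => ?_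
  split_ifs with hfilt
  · exact actOfLetters_killConv_of_filter hk P Op 𝒴 dom Jc V ℓ₀ hfilt o y
  · exact actOfLetters_killConv_of_not hk P Op 𝒴 dom Jc V ℓ₀ hℓ hfilt o y

variable [NormedAddCommGroup Op] [NormedSpace ℂ Op]

/-! ## §3 N0y's ENDs at the carriers of record FOR THE LABELS OF RECORD OF ANY LETTER FAMILY — no `hkill` -/

open Classical in
/-- **THE ATTACHED PART OF THE ACTIVITY OF RECORD OF ANY LETTER FAMILY `ℓ₀`, SUMMED OVER THE LABELS OF RECORD ONLY** — N1a PART 3's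
attached END `attachedPart_locE_le_of_actOfLetters_recordLabels_carriersBonds` ONCE at `ℓA := killConv hk … ℓ₀` with its displayed
`hkill` DISCHARGED by `hkill_killConv` (§1), its letters' binders `hN`∕`hq`∕`hAmp` TRANSPORTED from `ℓ₀`'s (§1∕§2: the convention touches
`cons` only), and ROW NE5's catalogue sum of the conclusion REWRITTEN as the FILTERED sum of `ℓ₀`'s activities
(`sum_innerLabels_actOfLetters_killConv`).  Displayed, verbatim from N1a: `hroom`; `hm`∕`hN`∕`hq` (now about `ℓ₀`); `hO`∕`hH`; (B3-form)
`hAmp` on the filtered labels (about `ℓ₀`'s cores); the located clauses; N0m's `hϱ`∕`hϱA`.  NO `hkill`: «which labels» is the summation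
RANGE (the owner's filter, BY FIAT), not a hypothesis on the letters.  Conclusion:
`‖E[Z ↦ Σ_{ℓ ∈ (torusLabels hk Z).filter F} actOfLetters ℓ₀ (domEmb R (k+1) Z) (ofTorus ℓ) o (h₀ + w)](X₀) − E[… o h₀](X₀)‖
≤ 4·(e·9·64·K₀(64,8)²)·A₁·e^{−r₁·torusTreeLen X₀}`. [folklore] -/
theorem attachedPart_locE_le_of_actOfLetters_recordLabels_any {Win : Set (ℕ → ℝ)}
    {ctr : ℕ → (ℕ → ℝ) → R.carriers.BgB → Op × B13HistM P} {ROp RHist R' : ℕ → ℝ}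
    {mq bq N₀ : ℕ → R.carriers.Dom × InnerLabel R.carriers.Dom (Bnd R) → R.carriers.Dom → ℝ}
    (hroom : ∀ k, ROp k < R' k)
    (hm : ∀ k, ∀ g ∈ Win, ∀ (U : R.carriers.BgB) (X : R.carriers.Dom), R.carriers.scale X = k → ∀ p, 0 < mq k p X)
    (hN : ∀ k, ∀ g ∈ Win, ∀ (U : R.carriers.BgB) (X : R.carriers.Dom), R.carriers.scale X = k →
      ∀ p : R.carriers.Dom × InnerLabel R.carriers.Dom (Bnd R),
      (∀ o ∈ ball (ctr k g U).1 (R' k),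
        AEStronglyMeasurable ((ℓ₀ p.1 p.2).N o) (coreOf P Op 𝒴 dom Jc V ℓ₀ p.1 p.2).lam) ∧
      (∀ a, DifferentiableOn ℂ (fun o => (ℓ₀ p.1 p.2).N o a) (ball (ctr k g U).1 (R' k))) ∧
      (∀ o ∈ ball (ctr k g U).1 (R' k), ∀ a, ‖(ℓ₀ p.1 p.2).N o a‖ ≤ N₀ k p X))
    (hq : ∀ k, ∀ g ∈ Win, ∀ (U : R.carriers.BgB) (X : R.carriers.Dom), R.carriers.scale X = k →
      ∀ p : R.carriers.Dom × InnerLabel R.carriers.Dom (Bnd R),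
      (∀ o ∈ ball (ctr k g U).1 (R' k),
        AEStronglyMeasurable (Function.uncurry ((ℓ₀ p.1 p.2).q o))
          ((coreOf P Op 𝒴 dom Jc V ℓ₀ p.1 p.2).lam.prod volume)) ∧
      (∀ a v, DifferentiableOn ℂ (fun o => (ℓ₀ p.1 p.2).q o a v) (ball (ctr k g U).1 (R' k))) ∧
      (∀ o ∈ ball (ctr k g U).1 (R' k), ∀ a v, mq k p X * ‖v‖ ^ 2 - bq k p X ≤ ((ℓ₀ p.1 p.2).q o a v).re))
    {g : ℕ → ℝ} (hg : g ∈ Win) {U : R.carriers.BgB} {o : Op} {h₀ w : B13HistM P} {ϱ : ℝ}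
    (hO : ‖o - (ctr (k + 1) g U).1‖ ≤ ROp (k + 1)) (hH : ‖h₀ - (ctr (k + 1) g U).2‖ + ϱ * ‖w‖ ≤ RHist (k + 1))
    {A₀ A₁ Rkp r₁ : ℝ} (X₀ : (tsys 4 (R.cubesPerDir (k + 1))).Dom) (hA₀ : 0 ≤ A₀) (hA₁ : 0 ≤ A₁) (hr₁ : 0 ≤ r₁)
    (hrate : r₁ + 2 * (64 * Real.log 162) + 2 ≤ Rkp)
    (hsmall : (A₀ + ϱ * A₁) * Real.exp (5 * r₁ + 1) * K₀ 64 8 * 9 * 64 ≤ 1)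
    {δ κ α₆ Rc s t : ℝ} (hα₆ : 0 ≤ α₆)
    (hκ : 64 * Real.log 162 + 1 ≤ δ * κ) (h229 : Real.exp 1 * K₀ 64 8 * 64 * α₆ ≤ 1)
    (hs0 : 0 ≤ s) (hs1 : s ≤ 1) (ht : 0 ≤ t)
    (hRR : Rkp ≤ Rc - 64 * (Real.exp (Rc * 5) * s * Real.exp ((4 * (R.F.L : ℝ) ^ (4 * R.m')) * t)))
    (hAmp : ∀ Z : (tsys 4 (R.cubesPerDir (k + 1))).Dom, Z.1 ⊆ X₀.1 → ∀ ℓ ∈ (torusLabels hk Z).filter fun ℓ =>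
        ℓ.Z₀ = trefineDom R.F.L (R.cubesPerDir (k + 1)) Z ∧
          ℓ.P ⊆ bondsOfFineCubes hk (ℓ.Z₀.1 \ ℓ.fam.biUnion fun Y : (tsys 4 (R.F.L * R.cubesPerDir (k + 1))).Dom => Y.1) ∧
          (ℓ.Z₀.1 \ ℓ.fam.biUnion fun Y : (tsys 4 (R.F.L * R.cubesPerDir (k + 1))).Dom => Y.1).card ≤ 2 * ℓ.P.card,
      (coreOf P Op 𝒴 dom Jc V ℓ₀ (domEmb R (k + 1) Z) (InnerLabel.ofTorus hk ℓ)).lam.real univ *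
          ((coreOf P Op 𝒴 dom Jc V ℓ₀ (domEmb R (k + 1) Z) (InnerLabel.ofTorus hk ℓ)).wB *
              N₀ (k + 1) (domEmb R (k + 1) Z, InnerLabel.ofTorus hk ℓ) (domEmb R (k + 1) Z) *
            Real.exp (bq (k + 1) (domEmb R (k + 1) Z, InnerLabel.ofTorus hk ℓ) (domEmb R (k + 1) Z))) *
          (Real.pi / (mq (k + 1) (domEmb R (k + 1) Z, InnerLabel.ofTorus hk ℓ) (domEmb R (k + 1) Z) / 2)) ^
            (Module.finrank ℝ (V (domEmb R (k + 1) Z) (InnerLabel.ofTorus hk ℓ)) / 2 : ℝ) *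
        Real.exp ((coreOf P Op 𝒴 dom Jc V ℓ₀ (domEmb R (k + 1) Z) (InnerLabel.ofTorus hk ℓ)).N₁ * (‖h₀‖ + ϱ * ‖w‖)) ≤
      (A₀ + ϱ * A₁) * ((∏ Y ∈ ℓ.fam, (α₆ * Real.exp (-(δ * κ * torusTreeLen Y.1)) *
        Real.exp (-(Rc * (torusTreeLen Y.1 + 5))))) * (s ^ 2 * t) ^ ℓ.P.card))
    (hϱ : 2 ≤ ϱ) (hϱA : A₀ ≤ ϱ * A₁) :
    ‖locE (tgeometry 4 (R.cubesPerDir (k + 1))).ι (tgeometry 4 (R.cubesPerDir (k + 1))).cubes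
          (fun Z => ∑ ℓ ∈ (torusLabels hk Z).filter fun ℓ =>
              ℓ.Z₀ = trefineDom R.F.L (R.cubesPerDir (k + 1)) Z ∧
                ℓ.P ⊆ bondsOfFineCubes hk (ℓ.Z₀.1 \ ℓ.fam.biUnion fun Y : (tsys 4 (R.F.L * R.cubesPerDir (k + 1))).Dom => Y.1) ∧
                (ℓ.Z₀.1 \ ℓ.fam.biUnion fun Y : (tsys 4 (R.F.L * R.cubesPerDir (k + 1))).Dom => Y.1).card ≤ 2 * ℓ.P.card,
            actOfLetters P Op 𝒴 dom Jc V ℓ₀ (domEmb R (k + 1) Z) (InnerLabel.ofTorus hk ℓ) o (h₀ + w))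
            ((tgeometry 4 (R.cubesPerDir (k + 1))).cubes X₀) -
        locE (tgeometry 4 (R.cubesPerDir (k + 1))).ι (tgeometry 4 (R.cubesPerDir (k + 1))).cubes
          (fun Z => ∑ ℓ ∈ (torusLabels hk Z).filter fun ℓ =>
              ℓ.Z₀ = trefineDom R.F.L (R.cubesPerDir (k + 1)) Z ∧
                ℓ.P ⊆ bondsOfFineCubes hk (ℓ.Z₀.1 \ ℓ.fam.biUnion fun Y : (tsys 4 (R.F.L * R.cubesPerDir (k + 1))).Dom => Y.1) ∧
                (ℓ.Z₀.1 \ ℓ.fam.biUnion fun Y : (tsys 4 (R.F.L * R.cubesPerDir (k + 1))).Dom => Y.1).card ≤ 2 * ℓ.P.card,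
            actOfLetters P Op 𝒴 dom Jc V ℓ₀ (domEmb R (k + 1) Z) (InnerLabel.ofTorus hk ℓ) o h₀)
            ((tgeometry 4 (R.cubesPerDir (k + 1))).cubes X₀)‖ ≤
      4 * (Real.exp 1 * 9 * 64 * K₀ 64 8 ^ 2) * A₁ * Real.exp (-(r₁ * (tsys 4 (R.cubesPerDir (k + 1))).dj X₀)) := by
  have key := attachedPart_locE_le_of_actOfLetters_recordLabels_carriersBonds R hk P Op 𝒴 dom Jc V
    (killConv hk P Op 𝒴 dom Jc V ℓ₀) hroom hm
    (fun k' g hg U X hX p => by simpa only [killConv_N, coreOf_killConv_lam] using hN k' g hg U X hX p)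
    (fun k' g hg U X hX p => by simpa only [killConv_q, coreOf_killConv_lam] using hq k' g hg U X hX p)
    hg hO hH (hkill_killConv hk P Op 𝒴 dom Jc V ℓ₀) X₀ hA₀ hA₁ hr₁ hrate hsmall hα₆ hκ h229 hs0 hs1 ht hRR
    (fun Z hZ ℓ hℓ => by
      simpa only [coreOf_killConv_lam, coreOf_killConv_wB, coreOf_killConv_N₁] using hAmp Z hZ ℓ hℓ)
    hϱ hϱA
  simpa only [sum_innerLabels_actOfLetters_killConv] using key

open Classical in
/-- **THE μ-PART (ROAD P1's SOURCE PENCIL) OF THE ACTIVITY OF RECORD OF ANY LETTER FAMILY `ℓ₀`, SUMMED OVER THE LABELS OF RECORD ONLY** —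
N1a PART 3's μ-END `muPart_locE_le_of_actOfLetters_recordLabels_carriersBonds` ONCE at `ℓA := killConv hk … ℓ₀`, `hkill` DISCHARGED
(`hkill_killConv`), `hN`∕`hq`∕`hAmp` transported from `ℓ₀`'s, the catalogue sums rewritten as filtered sums
(`sum_innerLabels_actOfLetters_killConv`).  Displayed, verbatim from N1a: `hroom`; `hm`∕`hN`∕`hq`; `hO`∕`hH`; `hAmp`; the located
clauses; road P1's `h0`∕`h01`∕`hμ`.  Conclusion:
`‖E[Z ↦ Σ_{ℓ ∈ (torusLabels hk Z).filter F} actOfLetters ℓ₀ (domEmb R (k+1) Z) (ofTorus ℓ) o (h₀ + sμ•v)](X₀) − E[… o h₀](X₀)‖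
≤ e·9·64·K₀(64,8)²·A·e^{−r₁·torusTreeLen X₀}·μ₀∕(μ₁ − μ₀)`. [folklore] -/
theorem muPart_locE_le_of_actOfLetters_recordLabels_any {Win : Set (ℕ → ℝ)}
    {ctr : ℕ → (ℕ → ℝ) → R.carriers.BgB → Op × B13HistM P} {ROp RHist R' : ℕ → ℝ}
    {mq bq N₀ : ℕ → R.carriers.Dom × InnerLabel R.carriers.Dom (Bnd R) → R.carriers.Dom → ℝ}
    (hroom : ∀ k, ROp k < R' k)
    (hm : ∀ k, ∀ g ∈ Win, ∀ (U : R.carriers.BgB) (X : R.carriers.Dom), R.carriers.scale X = k → ∀ p, 0 < mq k p X)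
    (hN : ∀ k, ∀ g ∈ Win, ∀ (U : R.carriers.BgB) (X : R.carriers.Dom), R.carriers.scale X = k →
      ∀ p : R.carriers.Dom × InnerLabel R.carriers.Dom (Bnd R),
      (∀ o ∈ ball (ctr k g U).1 (R' k),
        AEStronglyMeasurable ((ℓ₀ p.1 p.2).N o) (coreOf P Op 𝒴 dom Jc V ℓ₀ p.1 p.2).lam) ∧
      (∀ a, DifferentiableOn ℂ (fun o => (ℓ₀ p.1 p.2).N o a) (ball (ctr k g U).1 (R' k))) ∧
      (∀ o ∈ ball (ctr k g U).1 (R' k), ∀ a, ‖(ℓ₀ p.1 p.2).N o a‖ ≤ N₀ k p X))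
    (hq : ∀ k, ∀ g ∈ Win, ∀ (U : R.carriers.BgB) (X : R.carriers.Dom), R.carriers.scale X = k →
      ∀ p : R.carriers.Dom × InnerLabel R.carriers.Dom (Bnd R),
      (∀ o ∈ ball (ctr k g U).1 (R' k),
        AEStronglyMeasurable (Function.uncurry ((ℓ₀ p.1 p.2).q o))
          ((coreOf P Op 𝒴 dom Jc V ℓ₀ p.1 p.2).lam.prod volume)) ∧
      (∀ a v, DifferentiableOn ℂ (fun o => (ℓ₀ p.1 p.2).q o a v) (ball (ctr k g U).1 (R' k))) ∧
      (∀ o ∈ ball (ctr k g U).1 (R' k), ∀ a v, mq k p X * ‖v‖ ^ 2 - bq k p X ≤ ((ℓ₀ p.1 p.2).q o a v).re))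
    {g : ℕ → ℝ} (hg : g ∈ Win) {U : R.carriers.BgB} {o : Op} {h₀ v : B13HistM P} {μ₁ : ℝ}
    (hO : ‖o - (ctr (k + 1) g U).1‖ ≤ ROp (k + 1)) (hH : ‖h₀ - (ctr (k + 1) g U).2‖ + μ₁ * ‖v‖ ≤ RHist (k + 1))
    {A Rkp r₁ μ₀ : ℝ} (X₀ : (tsys 4 (R.cubesPerDir (k + 1))).Dom) {sμ : ℂ} (hA : 0 ≤ A) (hr₁ : 0 ≤ r₁)
    (hrate : r₁ + 2 * (64 * Real.log 162) + 2 ≤ Rkp)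
    (hsmall : A * Real.exp (5 * r₁ + 1) * K₀ 64 8 * 9 * 64 ≤ 1)
    {δ κ α₆ Rc s t : ℝ} (hα₆ : 0 ≤ α₆)
    (hκ : 64 * Real.log 162 + 1 ≤ δ * κ) (h229 : Real.exp 1 * K₀ 64 8 * 64 * α₆ ≤ 1)
    (hs0 : 0 ≤ s) (hs1 : s ≤ 1) (ht : 0 ≤ t)
    (hRR : Rkp ≤ Rc - 64 * (Real.exp (Rc * 5) * s * Real.exp ((4 * (R.F.L : ℝ) ^ (4 * R.m')) * t)))
    (hAmp : ∀ Z : (tsys 4 (R.cubesPerDir (k + 1))).Dom, Z.1 ⊆ X₀.1 → ∀ ℓ ∈ (torusLabels hk Z).filter fun ℓ =>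
        ℓ.Z₀ = trefineDom R.F.L (R.cubesPerDir (k + 1)) Z ∧
          ℓ.P ⊆ bondsOfFineCubes hk (ℓ.Z₀.1 \ ℓ.fam.biUnion fun Y : (tsys 4 (R.F.L * R.cubesPerDir (k + 1))).Dom => Y.1) ∧
          (ℓ.Z₀.1 \ ℓ.fam.biUnion fun Y : (tsys 4 (R.F.L * R.cubesPerDir (k + 1))).Dom => Y.1).card ≤ 2 * ℓ.P.card,
      (coreOf P Op 𝒴 dom Jc V ℓ₀ (domEmb R (k + 1) Z) (InnerLabel.ofTorus hk ℓ)).lam.real univ *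
          ((coreOf P Op 𝒴 dom Jc V ℓ₀ (domEmb R (k + 1) Z) (InnerLabel.ofTorus hk ℓ)).wB *
              N₀ (k + 1) (domEmb R (k + 1) Z, InnerLabel.ofTorus hk ℓ) (domEmb R (k + 1) Z) *
            Real.exp (bq (k + 1) (domEmb R (k + 1) Z, InnerLabel.ofTorus hk ℓ) (domEmb R (k + 1) Z))) *
          (Real.pi / (mq (k + 1) (domEmb R (k + 1) Z, InnerLabel.ofTorus hk ℓ) (domEmb R (k + 1) Z) / 2)) ^
            (Module.finrank ℝ (V (domEmb R (k + 1) Z) (InnerLabel.ofTorus hk ℓ)) / 2 : ℝ) *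
        Real.exp ((coreOf P Op 𝒴 dom Jc V ℓ₀ (domEmb R (k + 1) Z) (InnerLabel.ofTorus hk ℓ)).N₁ * (‖h₀‖ + μ₁ * ‖v‖)) ≤
      A * ((∏ Y ∈ ℓ.fam, (α₆ * Real.exp (-(δ * κ * torusTreeLen Y.1)) *
        Real.exp (-(Rc * (torusTreeLen Y.1 + 5))))) * (s ^ 2 * t) ^ ℓ.P.card))
    (h0 : 0 < μ₀) (h01 : μ₀ < μ₁) (hμ : ‖sμ‖ ≤ μ₀) :
    ‖locE (tgeometry 4 (R.cubesPerDir (k + 1))).ι (tgeometry 4 (R.cubesPerDir (k + 1))).cubes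
          (fun Z => ∑ ℓ ∈ (torusLabels hk Z).filter fun ℓ =>
              ℓ.Z₀ = trefineDom R.F.L (R.cubesPerDir (k + 1)) Z ∧
                ℓ.P ⊆ bondsOfFineCubes hk (ℓ.Z₀.1 \ ℓ.fam.biUnion fun Y : (tsys 4 (R.F.L * R.cubesPerDir (k + 1))).Dom => Y.1) ∧
                (ℓ.Z₀.1 \ ℓ.fam.biUnion fun Y : (tsys 4 (R.F.L * R.cubesPerDir (k + 1))).Dom => Y.1).card ≤ 2 * ℓ.P.card,
            actOfLetters P Op 𝒴 dom Jc V ℓ₀ (domEmb R (k + 1) Z) (InnerLabel.ofTorus hk ℓ) o (h₀ + sμ • v))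
            ((tgeometry 4 (R.cubesPerDir (k + 1))).cubes X₀) -
        locE (tgeometry 4 (R.cubesPerDir (k + 1))).ι (tgeometry 4 (R.cubesPerDir (k + 1))).cubes
          (fun Z => ∑ ℓ ∈ (torusLabels hk Z).filter fun ℓ =>
              ℓ.Z₀ = trefineDom R.F.L (R.cubesPerDir (k + 1)) Z ∧
                ℓ.P ⊆ bondsOfFineCubes hk (ℓ.Z₀.1 \ ℓ.fam.biUnion fun Y : (tsys 4 (R.F.L * R.cubesPerDir (k + 1))).Dom => Y.1) ∧
                (ℓ.Z₀.1 \ ℓ.fam.biUnion fun Y : (tsys 4 (R.F.L * R.cubesPerDir (k + 1))).Dom => Y.1).card ≤ 2 * ℓ.P.card,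
            actOfLetters P Op 𝒴 dom Jc V ℓ₀ (domEmb R (k + 1) Z) (InnerLabel.ofTorus hk ℓ) o h₀)
            ((tgeometry 4 (R.cubesPerDir (k + 1))).cubes X₀)‖ ≤
      Real.exp 1 * 9 * 64 * K₀ 64 8 ^ 2 * A * Real.exp (-(r₁ * (tsys 4 (R.cubesPerDir (k + 1))).dj X₀)) * (μ₀ / (μ₁ - μ₀)) := by
  have key := muPart_locE_le_of_actOfLetters_recordLabels_carriersBonds R hk P Op 𝒴 dom Jc V
    (killConv hk P Op 𝒴 dom Jc V ℓ₀) hroom hm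
    (fun k' g hg U X hX p => by simpa only [killConv_N, coreOf_killConv_lam] using hN k' g hg U X hX p)
    (fun k' g hg U X hX p => by simpa only [killConv_q, coreOf_killConv_lam] using hq k' g hg U X hX p)
    hg hO hH (hkill_killConv hk P Op 𝒴 dom Jc V ℓ₀) X₀ hA hr₁ hrate hsmall hα₆ hκ h229 hs0 hs1 ht hRR
    (fun Z hZ ℓ hℓ => by
      simpa only [coreOf_killConv_lam, coreOf_killConv_wB, coreOf_killConv_N₁] using hAmp Z hZ ℓ hℓ)
    h0 h01 hμ
  simpa only [sum_innerLabels_actOfLetters_killConv] using key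

end KillConvention

end Summit.QuantumFields.BalabanUV.T4Continuum.NE1p.DressedSmallFieldRecordLabelsKillConvention

end
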